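import Mathlib.NumberTheory.Padics.AddChar
import Mathlib.Topology.Homeomorph.Lemmas
import Literature.NumberTheory.EllipticCurves.ZpExtensionPadicUnitsProofs
import HarnessLib

/-!
# A non-trivial continuous character `ℤ_pˣ → ℤ_p` (the `γ`-adic logarithm; proofs only)

Companion to `ZpExtensionPadicUnitsProofs.lean` (`Hom_cont(ℤ_pˣ, ℤ_p)` has rank *at most* one):
here we show the rank is *at least* one, i.e. there is a continuous homomorphism
`g : ℤ_pˣ →ₜ* ℤ_p` which is not identically zero
(`Literature.NumberTheory.EllipticCurves.ZpExtension.PadicUnits.exists_continuousMonoidHom_ne_one`).  Classically `g = log_p`;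
we avoid the `p`-adic logarithm series (absent from Mathlib) and instead invert the
`γ`-adic exponential `x ↦ γˣ`, `γ = 1 + p³`, which Mathlib provides as the continuous additive
character `PadicInt.addChar_of_value_at_one (p³)` of `ℤ_p` (Mahler expansion): it is a
continuous bijection, hence a homeomorphism, from `ℤ_p` onto `U₃ = 1 + p³ℤ_p`
(injective by the order computation `ord(γ mod p^{n+3}) = pⁿ`, Mathlib's
`ZMod.orderOf_one_add_mul_prime_pow`; onto by density of `γ^ℕ` in `U₃`,
`PadicUnits.exists_pow_toZModPow_eq`), and `g(u) = log_γ(u^{(p-1)p²})` (`u^{(p-1)p²} ∈ U₃`).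

With the surjectivity of the cyclotomic character this yields a surjective character
`Γ_ℚ →ₜ* ℤ_p` (the cyclotomic `ℤ_p`-extension of `ℚ`) without class field theory; see
`ZpExtensionRatRankProofs.lean`.

## Main statements

* `PadicUnits.pow_prime_pow_sub_one_dvd`: `u ≡ 1 (p^k)`, `k ≥ 1` ⇒ `u^{pⁿ} ≡ 1 (p^{k+n})`.
* `PadicUnits.addChar_sub_one_dvd`, `PadicUnits.eq_zero_of_addChar_eq_one`,
  `PadicUnits.exists_addChar_eq`: a continuous additive character `e` of `ℤ_p` with
  `e 1 = 1 + p³` maps into `U₃`, is injective, and maps onto `U₃` (values of `e` are units: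
  Mathlib's `AddChar.val_isUnit`).
* `PadicUnits.exists_continuousMonoidHom_ne_one`: a continuous `g : ℤ_pˣ →ₜ* ℤ_p` and a unit
  `u` with `g u ≠ 0`.

## References

* Serre, *A Course in Arithmetic* (1973), Ch. II §3.2, Prop. 8 (`U₁ ≃ ℤ_p` via `x ↦ (1+p)ˣ`,
  `p ≠ 2`; `U₂ ≃ ℤ₂`).
* [Washington1997] L. C. Washington, *Introduction to Cyclotomic Fields*, 2nd ed. (1997), §5.1
  (`p`-adic exponential and logarithm) and §13.1.
* Mathlib: `Mathlib/NumberTheory/Padics/AddChar.lean` (D. Loeffler).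
-/

noncomputable section

open Filter Topology

namespace Literature.NumberTheory.EllipticCurves

namespace ZpExtension

namespace PadicUnits

variable {p : ℕ} [Fact p.Prime]

/-! ### Raising principal units to `p`-th powers -/

/-- If `u ≡ 1 (mod p^k)` with `k ≥ 1` then `u^p ≡ 1 (mod p^{k+1})`:
`u^p - 1 = (u - 1)(1 + u + ⋯ + u^{p-1})` and the second factor is `≡ p (mod p^k)`, hence
divisible by `p`.  Ref: Serre, *A Course in Arithmetic*, Ch. II §3.2, Lemma. [folklore] -/
theorem pow_prime_sub_one_dvd {k : ℕ} (hk : k ≠ 0) {u : ℤ_[p]} (hu : (p : ℤ_[p]) ^ k ∣ u - 1) :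
    (p : ℤ_[p]) ^ (k + 1) ∣ u ^ p - 1 := by
  obtain ⟨k, rfl⟩ : ∃ k', k = k' + 1 := Nat.exists_eq_succ_of_ne_zero hk
  obtain ⟨a, ha⟩ := hu
  have hgeom : (u - 1) ∣ (∑ i ∈ Finset.range p, u ^ i) - p := by
    have hs : (∑ i ∈ Finset.range p, u ^ i) - p = ∑ i ∈ Finset.range p, (u ^ i - 1) := by
      rw [Finset.sum_sub_distrib, Finset.sum_const, Finset.card_range, nsmul_eq_mul, mul_one]
    rw [hs]
    exact Finset.dvd_sum fun i _ => sub_one_dvd_pow_sub_one u i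
  obtain ⟨c, hc⟩ := hgeom
  have hsum : ∑ i ∈ Finset.range p, u ^ i = p + (u - 1) * c := by
    rw [← hc]
    ring
  rw [← geom_sum_mul, hsum, ha]
  exact ⟨a * (1 + (p : ℤ_[p]) ^ k * a * c), by ring⟩

/-- If `u ≡ 1 (mod p^k)` with `k ≥ 1` then `u^{pⁿ} ≡ 1 (mod p^{k+n})` (iterate
`pow_prime_sub_one_dvd`).  Ref: Serre, *A Course in Arithmetic*, Ch. II §3.2, Lemma. [folklore] -/
theorem pow_prime_pow_sub_one_dvd {k : ℕ} (hk : k ≠ 0) {u : ℤ_[p]}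
    (hu : (p : ℤ_[p]) ^ k ∣ u - 1) (n : ℕ) : (p : ℤ_[p]) ^ (k + n) ∣ u ^ p ^ n - 1 := by
  induction n with
  | zero => simpa using hu
  | succ n ih =>
    rw [pow_succ, pow_mul, ← add_assoc]
    exact pow_prime_sub_one_dvd (by omega) ih

/-- Every unit `u ∈ ℤ_pˣ` satisfies `u^{(p-1)p²} ∈ U₃ = 1 + p³ ℤ_p` (Fermat: `u^{p-1} ∈ U₁`,
`PadicUnits.norm_pow_sub_one_sub_one_lt`, then `pow_prime_pow_sub_one_dvd`).
Ref: Serre, *A Course in Arithmetic*, Ch. II §3.1–3.2. [folklore] -/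
theorem prime_pow_three_dvd_pow_sub_one (u : ℤ_[p]ˣ) :
    (p : ℤ_[p]) ^ 3 ∣ (u : ℤ_[p]) ^ ((p - 1) * p ^ 2) - 1 := by
  have h1 : (p : ℤ_[p]) ^ 1 ∣ (u : ℤ_[p]) ^ (p - 1) - 1 := by
    rw [pow_one, ← PadicInt.norm_lt_one_iff_dvd]
    exact norm_pow_sub_one_sub_one_lt u
  have h := pow_prime_pow_sub_one_dvd one_ne_zero h1 2
  rwa [pow_mul]

/-! ### The `γ`-adic exponential `e : x ↦ γˣ`, `γ = 1 + p³` -/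

/-- `(p³)ⁿ → 0` in `ℤ_p`, so that Mathlib's `PadicInt.addChar_of_value_at_one (p³)` — the
continuous additive character `e` of `ℤ_p` with `e 1 = 1 + p³`, i.e. `e x = (1 + p³)ˣ` — is
available.  Ref: Washington, *Introduction to Cyclotomic Fields*, §5.1. [folklore] -/
theorem tendsto_prime_pow_three_pow :
    Tendsto (fun n : ℕ => ((p : ℤ_[p]) ^ 3) ^ n) atTop (𝓝 0) := by
  have hp : p.Prime := Fact.out
  refine tendsto_pow_atTop_nhds_zero_of_norm_lt_one ?_
  rw [norm_pow, PadicInt.norm_p]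
  have h1 : (1 : ℝ) < p := by exact_mod_cast hp.one_lt
  exact pow_lt_one₀ (by positivity) (inv_lt_one_of_one_lt₀ h1) three_ne_zero

/-- There is a continuous additive character `e : ℤ_p → ℤ_p` (`e (x + y) = e x · e y`, `e 0 = 1`)
with `e 1 = 1 + p³` (Mathlib's Mahler-series construction `PadicInt.addChar_of_value_at_one`).
Ref: Washington, *Introduction to Cyclotomic Fields*, §5.1; Serre, *A Course in Arithmetic*,
Ch. II §3.2, Prop. 8. [folklore] -/
theorem exists_continuous_addChar :
    ∃ e : AddChar ℤ_[p] ℤ_[p], Continuous e ∧ e 1 = 1 + (p : ℤ_[p]) ^ 3 :=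
  ⟨PadicInt.addChar_of_value_at_one _ tendsto_prime_pow_three_pow,
    PadicInt.continuous_addChar_of_value_at_one _, PadicInt.addChar_of_value_at_one_def _⟩

section AddChar

variable (e : AddChar ℤ_[p] ℤ_[p])

/-- `e n = γⁿ` for `n : ℕ`, `γ = 1 + p³`. [folklore] -/
theorem addChar_natCast (he1 : e 1 = 1 + (p : ℤ_[p]) ^ 3) (n : ℕ) :
    e n = (1 + (p : ℤ_[p]) ^ 3) ^ n := by
  rw [← he1, ← AddChar.map_nsmul_eq_pow, nsmul_one]

variable (he : Continuous e) (he1 : e 1 = 1 + (p : ℤ_[p]) ^ 3)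
include he he1

/-- `e` takes values in `U₃ = 1 + p³ ℤ_p`: true on the dense subset `ℕ` (`γⁿ - 1` is divisible by
`γ - 1 = p³`) and `U₃` is closed.  Ref: Serre, *A Course in Arithmetic*, Ch. II §3.2. [folklore] -/
theorem addChar_sub_one_dvd (x : ℤ_[p]) : (p : ℤ_[p]) ^ 3 ∣ e x - 1 := by
  have hclosed : IsClosed {x : ℤ_[p] | (p : ℤ_[p]) ^ 3 ∣ e x - 1} := by
    have hset : {x : ℤ_[p] | (p : ℤ_[p]) ^ 3 ∣ e x - 1} =
        (fun x => e x - 1) ⁻¹' Metric.closedBall (0 : ℤ_[p]) ((p : ℝ) ^ (-(3 : ℕ) : ℤ)) := by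
      ext x
      rw [Set.mem_setOf_eq, Set.mem_preimage, Metric.mem_closedBall, dist_zero_right,
        PadicInt.norm_le_pow_iff_mem_span_pow, Ideal.mem_span_singleton]
    rw [hset]
    exact Metric.isClosed_closedBall.preimage (he.sub continuous_const)
  refine PadicInt.denseRange_natCast.induction_on x hclosed fun n => ?_
  change (p : ℤ_[p]) ^ 3 ∣ e n - 1
  rw [addChar_natCast e he1]
  have h := sub_one_dvd_pow_sub_one (1 + (p : ℤ_[p]) ^ 3) n
  rwa [add_sub_cancel_left] at h

/-- **`e` is injective**: if `e x = 1` then `x = 0`.  Writing `x = xₙ + pⁿ y` with `xₙ ∈ ℕ`,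
`e x = γ^{xₙ} · (e y)^{pⁿ} ≡ γ^{xₙ} (mod p^{n+3})`; so `γ^{xₙ} ≡ 1 (mod p^{n+3})`, and since
`γ = 1 + p³` has order `pⁿ` modulo `p^{n+3}` (`ZMod.orderOf_one_add_mul_prime_pow`), `pⁿ ∣ xₙ`,
i.e. `x ∈ pⁿ ℤ_p`; this for all `n`.  Ref: Serre, *A Course in Arithmetic*, Ch. II §3.2,
Prop. 8 (`θ : ℤ_p → U₁` is injective). [folklore] -/
theorem eq_zero_of_addChar_eq_one {x : ℤ_[p]} (hx : e x = 1) : x = 0 := by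
  have hp : p.Prime := Fact.out
  refine eq_zero_of_forall_pow_dvd fun n => ?_
  haveI : NeZero (p ^ (n + 3)) := ⟨pow_ne_zero _ hp.ne_zero⟩
  -- `x = xₙ + pⁿ y`
  set xn : ℕ := (PadicInt.toZModPow n x).val with hxn
  have hxmem : x - xn ∈ RingHom.ker (PadicInt.toZModPow n : ℤ_[p] →+* ZMod (p ^ n)) := by
    rw [RingHom.mem_ker, map_sub, map_natCast, hxn, ZMod.natCast_zmod_val, sub_self]
  rw [PadicInt.ker_toZModPow, Ideal.mem_span_singleton] at hxmem
  obtain ⟨y, hy⟩ := hxmem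
  have hxeq : x = xn + (p ^ n : ℕ) • y := by
    rw [nsmul_eq_mul, Nat.cast_pow, ← hy, add_sub_cancel]
  -- `e x = γ^{xₙ} · (e y)^{pⁿ}` with `(e y)^{pⁿ} ≡ 1 (mod p^{n+3})`
  have hex : e x = (1 + (p : ℤ_[p]) ^ 3) ^ xn * e y ^ p ^ n := by
    rw [hxeq, AddChar.map_add_eq_mul, addChar_natCast e he1, AddChar.map_nsmul_eq_pow]
  have hy3 : (p : ℤ_[p]) ^ (3 + n) ∣ e y ^ p ^ n - 1 :=
    pow_prime_pow_sub_one_dvd three_ne_zero (addChar_sub_one_dvd e he he1 y) n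
  -- reduce modulo `p^{n+3}`
  have hred1 : PadicInt.toZModPow (n + 3) (e y ^ p ^ n) = 1 := by
    rw [← sub_eq_zero, ← map_one (PadicInt.toZModPow (n + 3)), ← map_sub, ← RingHom.mem_ker,
      PadicInt.ker_toZModPow, Ideal.mem_span_singleton, add_comm]
    exact hy3
  have hγpow : ((1 + (p : ZMod (p ^ (n + 3))) ^ 3) : ZMod (p ^ (n + 3))) ^ xn = 1 := by
    have h := congrArg (PadicInt.toZModPow (n + 3)) hex
    rw [hx, map_one, map_mul, hred1, mul_one, map_pow, map_add, map_one, map_pow,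
      map_natCast] at h
    exact h.symm
  -- the order of `γ` modulo `p^{n+3}` is `pⁿ`
  have horder : orderOf ((1 + (p : ZMod (p ^ (n + 3))) ^ 3 : ZMod (p ^ (n + 3)))) = p ^ n := by
    have h35 : 3 + 2 ≤ p * 3 := by have := hp.two_le; omega
    have ha : ¬ (p : ℤ) ∣ 1 := by
      intro H
      apply hp.ne_one
      simpa using Int.eq_one_of_dvd_one (Int.natCast_nonneg p) H
    have h := ZMod.orderOf_one_add_mul_prime_pow hp 3 three_ne_zero h35 1 ha n
    simpa only [Int.cast_one, mul_one] using h
  have hdvd : p ^ n ∣ xn := by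
    rw [← horder]
    exact orderOf_dvd_of_pow_eq_one hγpow
  -- hence `x ∈ pⁿ ℤ_p`
  have hx0 : PadicInt.toZModPow n x = 0 := by
    rw [← ZMod.natCast_zmod_val (PadicInt.toZModPow n x), ← hxn,
      ZMod.natCast_eq_zero_iff]
    exact hdvd
  rw [← Ideal.mem_span_singleton, ← PadicInt.ker_toZModPow, RingHom.mem_ker]
  exact hx0

/-- **`e` maps onto `U₃`**: every `v ≡ 1 (mod p³)` is of the form `e x`.  The range of `e` is
compact, hence closed, and `v` is in its closure since `γ^ℕ` is dense in `U₃`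
(`PadicUnits.exists_pow_toZModPow_eq`: `v ≡ γ^k (mod p^{n+3})` for some `k`).
Ref: Serre, *A Course in Arithmetic*, Ch. II §3.2, Prop. 8 (`θ` is surjective). [folklore] -/
theorem exists_addChar_eq {v : ℤ_[p]} (hv : (p : ℤ_[p]) ^ 3 ∣ v - 1) : ∃ x : ℤ_[p], e x = v := by
  have hp : p.Prime := Fact.out
  -- `v` and `γ` as units
  have hγ : IsUnit (1 + (p : ℤ_[p]) ^ 3) := isUnit_one_add_prime_pow_three
  have hvnorm : ‖v - 1‖ < 1 := by
    rw [PadicInt.norm_lt_one_iff_dvd]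
    exact (dvd_pow_self (p : ℤ_[p]) three_ne_zero).trans hv
  have hvunit : IsUnit v := by
    rw [PadicInt.isUnit_iff]
    have h : ‖v + -1‖ < ‖(-1 : ℤ_[p])‖ := by rwa [norm_neg, norm_one, ← sub_eq_add_neg]
    rw [PadicInt.norm_eq_of_norm_add_lt_right h, norm_neg, norm_one]
  have hv3 : PadicInt.toZModPow 3 ((hvunit.unit : ℤ_[p]ˣ) : ℤ_[p]) = 1 := by
    rw [IsUnit.unit_spec, ← sub_eq_zero, ← map_one (PadicInt.toZModPow 3), ← map_sub,
      ← RingHom.mem_ker, PadicInt.ker_toZModPow, Ideal.mem_span_singleton]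
    exact hv
  -- `v` is in the closure of the (closed) range of `e`
  have hclosed : IsClosed (Set.range e) := (isCompact_range he).isClosed
  suffices hmem : v ∈ closure (Set.range e) by
    rw [hclosed.closure_eq] at hmem
    exact hmem
  rw [Metric.mem_closure_iff]
  intro ε hε
  obtain ⟨n, hn⟩ := PadicInt.exists_pow_neg_lt p hε
  obtain ⟨k, hk⟩ := exists_pow_toZModPow_eq (γ := hγ.unit) (v := hvunit.unit)
    (IsUnit.unit_spec hγ) hv3 n
  refine ⟨e k, ⟨k, rfl⟩, lt_of_le_of_lt ?_ ((zpow_le_zpow_right₀ (by exact_mod_cast hp.one_le)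
    (by omega : (-(((n + 3 : ℕ)) : ℤ)) ≤ -(n : ℤ))).trans_lt hn)⟩
  rw [dist_eq_norm, PadicInt.norm_le_pow_iff_mem_span_pow, ← PadicInt.ker_toZModPow,
    RingHom.mem_ker, map_sub, sub_eq_zero, addChar_natCast e he1, ← IsUnit.unit_spec hγ]
  rw [IsUnit.unit_spec] at hk
  exact hk.symm

end AddChar

/-! ### A non-trivial continuous character of `ℤ_pˣ` -/

/-- **`Hom_cont(ℤ_pˣ, ℤ_p) ≠ 0`.**  There is a continuous homomorphism `g : ℤ_pˣ →ₜ* ℤ_p` and a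
unit `u` with `g u ≠ 0`: namely `g u = log_γ (u^{(p-1)p²})`, where `log_γ : U₃ → ℤ_p` is the
inverse of the homeomorphism `x ↦ γˣ` of `ℤ_p` onto `U₃ = 1 + p³ℤ_p` (a continuous bijection
from a compact space to a Hausdorff space), and `u = γ = 1 + p³`, `g γ = (p-1)p² ≠ 0`.
Ref: Serre, *A Course in Arithmetic*, Ch. II §3.2, Prop. 8 and Thm. 2 (`ℤ_pˣ ≃ μ × ℤ_p`);
Washington, *Introduction to Cyclotomic Fields*, §5.1 (`log_p`). [folklore] -/
theorem exists_continuousMonoidHom_ne_one :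
    ∃ (g : ℤ_[p]ˣ →ₜ* Multiplicative ℤ_[p]) (u : ℤ_[p]ˣ), g u ≠ 1 := by
  have hp : p.Prime := Fact.out
  obtain ⟨e, he, he1⟩ := exists_continuous_addChar (p := p)
  -- `e` as a continuous bijection `ℤ_p → U₃`
  let U3 : Set ℤ_[p] := {v | (p : ℤ_[p]) ^ 3 ∣ v - 1}
  let f : ℤ_[p] → U3 := fun x => ⟨e x, addChar_sub_one_dvd e he he1 x⟩
  have hf_inj : Function.Injective f := by
    intro x y hxy
    have hxy' : e x = e y := congrArg Subtype.val hxy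
    have h1 : e (x - y) = 1 := by
      have h2 : e y * e (x - y) = e y * 1 := by
        rw [mul_one, ← AddChar.map_add_eq_mul, add_sub_cancel, hxy']
      exact (AddChar.val_isUnit e y).mul_left_cancel h2
    exact sub_eq_zero.mp (eq_zero_of_addChar_eq_one e he he1 h1)
  have hf_surj : Function.Surjective f := by
    rintro ⟨v, hv⟩
    obtain ⟨x, hx⟩ := exists_addChar_eq e he he1 hv
    exact ⟨x, Subtype.ext hx⟩
  have hf_cont : Continuous f := he.subtype_mk _
  let Φ : ℤ_[p] ≃ₜ U3 :=
    Continuous.homeoOfEquivCompactToT2 (f := Equiv.ofBijective f ⟨hf_inj, hf_surj⟩) hf_cont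
  have hΦ : ∀ x, (Φ x : ℤ_[p]) = e x := fun x => rfl
  -- `log_γ = Φ.symm` is additive
  have hlog_mul : ∀ (a b : ℤ_[p]) (ha : a ∈ U3) (hb : b ∈ U3) (hab : a * b ∈ U3),
      Φ.symm ⟨a * b, hab⟩ = Φ.symm ⟨a, ha⟩ + Φ.symm ⟨b, hb⟩ := by
    intro a b ha hb hab
    apply Φ.injective
    apply Subtype.ext
    rw [Φ.apply_symm_apply, hΦ, AddChar.map_add_eq_mul, ← hΦ, ← hΦ, Φ.apply_symm_apply,
      Φ.apply_symm_apply]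
  have hlog_one : ∀ (h1 : (1 : ℤ_[p]) ∈ U3), Φ.symm ⟨1, h1⟩ = 0 := by
    intro h1
    apply Φ.injective
    apply Subtype.ext
    rw [Φ.apply_symm_apply, hΦ, AddChar.map_zero_eq_one]
  -- the character `g u = log_γ (u ^ N)`, `N = (p - 1) p²`
  set N : ℕ := (p - 1) * p ^ 2 with hN
  let g₀ : ℤ_[p]ˣ → Multiplicative ℤ_[p] := fun u =>
    Multiplicative.ofAdd (Φ.symm ⟨(u : ℤ_[p]) ^ N, prime_pow_three_dvd_pow_sub_one u⟩)
  have hg₀_one : g₀ 1 = 1 := by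
    change Multiplicative.ofAdd (Φ.symm ⟨((1 : ℤ_[p]ˣ) : ℤ_[p]) ^ N, _⟩) = 1
    rw [← ofAdd_zero]
    congr 1
    have h1 : ((1 : ℤ_[p]ˣ) : ℤ_[p]) ^ N = 1 := by rw [Units.val_one, one_pow]
    rw [← hlog_one (h1 ▸ prime_pow_three_dvd_pow_sub_one 1)]
    congr 1
    exact Subtype.ext h1
  have hg₀_mul : ∀ u v, g₀ (u * v) = g₀ u * g₀ v := by
    intro u v
    change Multiplicative.ofAdd (Φ.symm ⟨((u * v : ℤ_[p]ˣ) : ℤ_[p]) ^ N, _⟩) =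
      Multiplicative.ofAdd (Φ.symm ⟨(u : ℤ_[p]) ^ N, _⟩) *
        Multiplicative.ofAdd (Φ.symm ⟨(v : ℤ_[p]) ^ N, _⟩)
    rw [← ofAdd_add, ← hlog_mul _ _ (prime_pow_three_dvd_pow_sub_one u)
      (prime_pow_three_dvd_pow_sub_one v)
      (by rw [← mul_pow, ← Units.val_mul]; exact prime_pow_three_dvd_pow_sub_one (u * v))]
    congr 2
    apply Subtype.ext
    change ((u * v : ℤ_[p]ˣ) : ℤ_[p]) ^ N = (u : ℤ_[p]) ^ N * (v : ℤ_[p]) ^ N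
    rw [Units.val_mul, mul_pow]
  have hg₀_cont : Continuous g₀ :=
    continuous_ofAdd.comp (Φ.symm.continuous.comp
      ((Units.continuous_val.pow N).subtype_mk _))
  let g : ℤ_[p]ˣ →ₜ* Multiplicative ℤ_[p] :=
    { toFun := g₀, map_one' := hg₀_one, map_mul' := hg₀_mul, continuous_toFun := hg₀_cont }
  -- `g γ = N ≠ 0`
  have hγ : IsUnit (1 + (p : ℤ_[p]) ^ 3) := isUnit_one_add_prime_pow_three
  refine ⟨g, hγ.unit, ?_⟩
  change Multiplicative.ofAdd (Φ.symm ⟨((hγ.unit : ℤ_[p]ˣ) : ℤ_[p]) ^ N, _⟩) ≠ 1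
  rw [← ofAdd_zero, Ne, Multiplicative.ofAdd.apply_eq_iff_eq]
  have hval : Φ.symm ⟨((hγ.unit : ℤ_[p]ˣ) : ℤ_[p]) ^ N, prime_pow_three_dvd_pow_sub_one _⟩ =
      (N : ℤ_[p]) := by
    apply Φ.injective
    rw [Φ.apply_symm_apply]
    apply Subtype.ext
    change ((hγ.unit : ℤ_[p]ˣ) : ℤ_[p]) ^ N = (Φ (N : ℤ_[p]) : ℤ_[p])
    rw [hΦ, addChar_natCast e he1, IsUnit.unit_spec]
  rw [hval, Nat.cast_eq_zero]
  have h1 : 0 < p - 1 := by have := hp.two_le; omega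
  exact (Nat.mul_pos h1 (pow_pos hp.pos 2)).ne'

end PadicUnits

end ZpExtension

end Literature.NumberTheory.EllipticCurves
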